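/- Copyright: the b2b-balaban cell (near-miss cell 7), T⁴-continuum fan-out; row NE7b ROUND-2 swarm, seat
t4-ne7b-formalise-leaf-08 (gen 13) (leaf-08's smallness-census lane F-leaf08g8-1 ∕ S12m ∕ S12q: «THE INFRARED FACTOR
DISPLAYED» = row S12r, file 1∕3 — the bottom of the window's END chain at the EXPLICIT pay threshold; INTENT journal l.20193,
owner GO R-OWNER-24-3 l.20269).
Released under the licence of the surrounding project. -/
import Summits.QuantumFields.BalabanUV.T4Continuum.Support.HistoryAssemblyRealiseMult
import Summits.QuantumFields.BalabanUV.T4Continuum.Support.HistoryPayThresholdRoot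

/-!
# History assembly over tree slots and per-term readings AT THE EXPLICIT (ROOT) PAY THRESHOLD

Summits-side support leaf of the T⁴-continuum cell (rung (B)+1 on a FINITE torus only; NOT infinite volume, NOT the
mass gap, NOT the Clay statement; NOT a proof of the spine estimate NE7b).  Claim table
`t4/b2b-balaban-t4-ne7b-p1/LEAVES-NE7b.md`, leaf-08's smallness-census lane (F-leaf08g8-1 ∕ rows S12m, S12q): row S12r
«THE INFRARED FACTOR DISPLAYED» (owner GO R-OWNER-24-3, journal l.20269), file 1∕3.

WHY.  The only window theorem in the tree, row S12q's
`HistoryRealiseCellsRunWindowT3bPc.hybridNE7_of_realisedDomainsRun_windowT3bPDc` (p232166), displays the coupling window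
`W = min (min 1 e^{−irThresholdTLE∕2}) (second factor)`; its second factor is a closed form (the census's «0.31» at
`p₀ = 23`), its FIRST factor uses the NAMED threshold `HistoryExitLE.irThresholdTLE := Classical.choose …`, of which no
size is derivable in the kernel in either direction.  The census wording of record (owner, (11q), journal l.19799) sizes
the first factor on the one road where the threshold IS explicit — leaf-08 gen 8's `HistoryPayThresholdRoot.payThresholdRoot`
(p225123: the max of seven root clauses; every clause a FLOOR, v1.1 p232877) — but that road stopped at the EXIT
`relWeightBound_canon_of_payThresholdRootLE`: no END, hence no window theorem, ran on it.  This file and its two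
successors (`HistoryAssemblyRealiseRunMultPPayRoot`, `HistoryRealiseCellsRunWindowT3bPcPayRoot`) re-plug the window's
END chain at the explicit threshold, each theorem the tree's VERBATIM with the ONE binder
`hir : irThresholdTLE C F.L rr β₀ ≤ log (g²)⁻¹` re-lettered to `payThresholdRoot C F.L rr β₀` and its callee swapped.

WHAT.  §1 **`hybridNE7_of_treeBinders_canonPayRoot`** = `HistoryAssemblyTreesLE.hybridNE7_of_treeBinders_canonLE`
(p210307) at the explicit threshold (exit := p225123's `relWeightBound_canon_of_payThresholdRootLE`).
§2 **`hybridNE7_of_termReadingLE_multPayRoot`** = `HistoryAssemblyRealiseMult.hybridNE7_of_termReadingLE_mult` (p219242)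
at the explicit threshold, over §1.  Token diff per theorem against its original: the name, the `hir` binder, the
callee — nothing else.

HONEST READING (c4).  Re-plumbing of OUR ENDs over OUR explicit threshold; the ENDs of record on the named threshold
(p210307, p219242, … , END v3.1′ p223694, pinned p224056, headline p224237, window p232166) are UNCHANGED BY NAME and not
superseded (the two thresholds are incomparable in the kernel; neither road implies the other).  [folklore] composition
by name; no `def`, no `structure`, no `Prop`-fact minted (c1), no `[cite:]` tag, nothing printed asserted (ABSOLUTE RULE),
constants symbolic (c2∕c6), no exit ∕ socket ∕ `HistoryConstants*` ∕ landed file touched (c3).  Displayed as before: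
constants, flow (⇐ BetaPertHyp), tuning, the (2.5) side condition, (B) side, H3 readings, the seam data (NE7c's
`ShellWeightBound`, NE7's `ReindexedBudget`, four summable rates).  NE7b NOT proved; spine PROVED 0∕9.  HONEST DEPENDENCY
(cell): continuum YM on T⁴ ⇐ BetaPertH ∧ nine spine estimates (0/9 proved); BetaPertH ⇐ (D1) ∧ (D4) ∧ CAP+tail; G-an2-4
gates asym, D1 and NE2/3/4.  This file changes none of it. -/

open Finset MeasureTheory
open Literature.MathematicalPhysics.QuantumFieldTheory.Balaban1983to89
open T4PersistenceDictionary T4PersistentHistoryCount T4BankedInduction T4PrintedShapeBanking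
open T4WeightBudget T4GlobalDenominator T4LiveClassFibration T4LiveStructureGas T4LiveGasToTerms T4RecordPriceSeam
open T4PartnerMultiplicity T4IndicatorShell T4MatchingAssembly T4MatchingClosure T4MatchingClosureSocket T4Continuum
open T4StabilitySocket T4BranchingRecordsGas T4TaggedShapeBanking T4CanonicalMenus T4RenewalChains
open Summit.QuantumFields.BalabanUV.T4Continuum.PlacementBatch
open Summit.QuantumFields.BalabanUV.T4Continuum.PlacementSkeleton
open Summit.QuantumFields.BalabanUV.T4Continuum.CountThresholdUniform
open Summit.QuantumFields.BalabanUV.T4Continuum.CountThresholdExit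
open Summit.QuantumFields.BalabanUV.T4Continuum.CountSeamJunction
open Summit.QuantumFields.BalabanUV.T4Continuum.LateMergers
open Summit.QuantumFields.BalabanUV.T4Continuum.HistoryFlow
open Summit.QuantumFields.BalabanUV.T4Continuum.HistoryRegeneration
open Summit.QuantumFields.BalabanUV.T4Continuum.HistoryTables
open Summit.QuantumFields.BalabanUV.T4Continuum.HistoryAssemblyTrees
open Summit.QuantumFields.BalabanUV.T4Continuum.HistoryAssemblyTerms
open Summit.QuantumFields.BalabanUV.T4Continuum.HistoryAssemblyPedigree
open Summit.QuantumFields.BalabanUV.T4Continuum.HistoryConstants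
open Summit.QuantumFields.BalabanUV.T4Continuum.HistoryGen
open Literature.MathematicalPhysics.QuantumFieldTheory.Balaban1983to89.B13ScaleTransfer
open Summit.QuantumFields.BalabanUV.T4Continuum.ZoneSkeleton
open Summit.QuantumFields.BalabanUV.T4Continuum.HistorySocketTH
open Summit.QuantumFields.BalabanUV.T4Continuum.HistoryCaps
open Summit.QuantumFields.BalabanUV.T4Continuum.HistoryAssemblyPrice
open Summit.QuantumFields.BalabanUV.T4Continuum.HistoryBankingLE
open Summit.QuantumFields.BalabanUV.T4Continuum.HistoryExitLE
open Summit.QuantumFields.BalabanUV.T4Continuum.HistoryAssemblyTreesLE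
open Summit.QuantumFields.BalabanUV.T4Continuum.HistoryAssemblyTermsLE
open Summit.QuantumFields.BalabanUV.T4Continuum.HistoryRealise
open Summit.QuantumFields.BalabanUV.T4Continuum.HistoryAssemblyRealiseLE
open Summit.QuantumFields.BalabanUV.T4Continuum.HistoryAssemblyMult
open Summit.QuantumFields.BalabanUV.T4Continuum.HistoryAssemblyMultKey
open Summit.QuantumFields.BalabanUV.T4Continuum.HistoryAssemblyRealiseMult
open Summit.QuantumFields.BalabanUV.T4Continuum.HistoryPayThresholdRoot

namespace Summit.QuantumFields.BalabanUV.T4Continuum.HistoryAssemblyTreesPayRoot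

noncomputable section

/-! ## §1 The tree-slot exit at the explicit threshold along the tuned runs, everything kernel-able plugged -/

section ExitLevel

variable {F : T4Family} {G : Type*} [GaugeGroup G] [MeasurableSpace G] [HaarData G] [RegularGaugeGroup G]
variable {ε : Type*} [DecidableEq ε]
variable {ι κc : Type*} [DecidableEq κc] [DecidableEq ι] {l₀ vol : ℝ} {K₀ : ℕ} {π : ℕ → ι → κc}
  {T : ℕ → Finset ι} {A A' shA shB : ℕ → ℝ → ι → ℝ} {Bad' : ℕ → ℝ → Finset κc} {dead dead' : ℕ → ℝ → ι → ℝ}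
  {Fc Rf Fc' Rf' : ℕ → κc → ℝ} {nup mup : ℕ → ℝ → ℝ} {Nup : ℝ}
  {Cc Rr CcRec RrRec : ℕ → ℝ → ι → ℝ} {ν u s₂ q₀ r s Wsh : ℕ → ℝ}

/-- **NE7b's COUNT EXIT OVER TREE SLOTS, NO RENEWAL-AT-REACH CLAUSE, AT THE EXPLICIT (ROOT) PAY THRESHOLD.**
`HistoryAssemblyTreesLE.hybridNE7_of_treeBinders_canonLE` (p210307) VERBATIM with the single binder `hir` re-lettered
`irThresholdTLE C F.L rr β₀ ↦ HistoryPayThresholdRoot.payThresholdRoot C F.L rr β₀` — the EXPLICIT threshold of leaf-08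
gen 8 (p225123: max of seven ROOT clauses, a closed form of the symbolic constants `(C, F.L, rr, β₀)`) in place of the
NAMED `Classical.choose` witness; proof = the same composition with the exit `relWeightBound_canon_of_payThresholdRootLE`
(p225123 §3) in place of `HistoryExitLE.relWeightBound_canon_of_irThresholdLE`.  Conclusion and every other binder
byte-identical.  NE7b NOT proved. [folklore] -/
theorem hybridNE7_of_treeBinders_canonPayRoot (D : FiniteEpsData F G) (sh : ε → PEv) {C : T4PrintedShapeBanking.Consts}
    {rr : ℕ} {β₀ : ℝ} (h : ThresholdOK C F.L rr β₀) (hμ : 0 < C.μ) (d n : ℕ) (Dcap Ncap : ℕ → ℕ)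
    -- two largeness conditions on the free bank constants
    (hκ₁ : (d : ℝ) * Real.log F.L + 2 * Real.log 2 ≤ C.κ₁) (hE₀ : Real.log (2 + birthMass C) ≤ C.E₀)
    -- the flow side (⇐ BetaPertH, displayed) and tuning
    {γ₀ γb b β' : ℝ} {pe : ℕ} (hb : 0 ≤ b) (hlo : FlowStep.BetaLowerH b γ₀ D.βfun)
    (hhi : FlowStep.BetaUpperH β' γ₀ D.βfun) (hγ : γb ≤ γ₀) (hγβ : γb ^ 2 * β' < 1)
    (S : B14FlowStep.SmallnessFor γb β' β₀ F.L pe) (hp₀ : C.p₀ ≤ pe) (hrr : rr ≤ pe)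
    {g : ℝ} {g₀ : ℕ → ℝ} (ht : D.Tuned γb g g₀)
    (hir : payThresholdRoot C F.L rr β₀ ≤ Real.log (g ^ 2)⁻¹)
    -- the (B) side
    (hsign : B16.SignConventions D.C) {γB : ℝ} {em ep : ℝ → ℝ} (hcor : B16.Cor3With D.C γB em ep) (hγB : γb ≤ γB)
    {obs : (K : ℕ) → GaugeField (F.P K) 0 G → ℝ} {B : ℝ}
    (hobs : ∀ K, Measurable (obs K)) (hbd : ∀ K U, |obs K U| ≤ B)
    (hα : ∀ K t, |t| ≤ l₀ → K₀ ≤ K →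
      ∫ U, Real.exp (t * obs K U) * D.dens K (g₀ K) 0 U ∂fieldMeasure (F.P K) 0 G ≤ ∑ τ ∈ T K, A K t τ)
    (hα' : ∀ K t, |t| ≤ l₀ → K₀ ≤ K →
      ∫ U, Real.exp (t * obs (K + 1) U) * D.dens (K + 1) (g₀ (K + 1)) 0 U ∂fieldMeasure (F.P (K + 1)) 0 G ≤
        ∑ τ ∈ T K, A' K t τ)
    {c₀ n₁ : ℝ} (hc₀ : 0 < c₀) (hfloor : ∀ K, K₀ ≤ K → c₀ ≤ smallFieldMass D K (g₀ K))
    (hfloor' : ∀ K, K₀ ≤ K → c₀ ≤ smallFieldMass D (K + 1) (g₀ (K + 1)))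
    (hsites : ∀ K, K₀ ≤ K → ((D.C ⟨K, F.m, g₀ K⟩).numSites K : ℝ) ≤ n₁)
    (hsites' : ∀ K, K₀ ≤ K → ((D.C ⟨K + 1, F.m, g₀ (K + 1)⟩).numSites (K + 1) : ℝ) ≤ n₁)
    (hNup : 0 ≤ Nup) (hnup : ∀ K t, |t| ≤ l₀ → K₀ ≤ K → 0 ≤ nup K t ∧ nup K t ≤ Nup)
    (hmup : ∀ K t, |t| ≤ l₀ → K₀ ≤ K → 0 ≤ mup K t ∧ mup K t ≤ Nup)
    -- H3: the displayed numerator reading of both runs over the ABSTRACT term family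
    (bad_subset : ∀ K t, |t| ≤ l₀ → K₀ ≤ K → Bad' K t ⊆ classIndex π T K)
    (up : ∀ K t, |t| ≤ l₀ → K₀ ≤ K → ∀ c ∈ Bad' K t, ∀ τ ∈ fibre π T K c, A K t τ ≤ dead K t τ * Fc K c * nup K t)
    (dead_nonneg : ∀ K t, |t| ≤ l₀ → K₀ ≤ K → ∀ c ∈ Bad' K t, ∀ τ ∈ fibre π T K c, 0 ≤ dead K t τ)
    (resum : ∀ K t, |t| ≤ l₀ → K₀ ≤ K → ∀ c ∈ Bad' K t, ∑ τ ∈ fibre π T K c, dead K t τ ≤ Rf K c)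
    (F_nonneg : ∀ K t, |t| ≤ l₀ → K₀ ≤ K → ∀ c ∈ Bad' K t, 0 ≤ Fc K c)
    (up' : ∀ K t, |t| ≤ l₀ → K₀ ≤ K → ∀ c ∈ Bad' K t, ∀ τ ∈ fibre π T K c,
      A' K t τ ≤ dead' K t τ * Fc' K c * mup K t)
    (dead'_nonneg : ∀ K t, |t| ≤ l₀ → K₀ ≤ K → ∀ c ∈ Bad' K t, ∀ τ ∈ fibre π T K c, 0 ≤ dead' K t τ)
    (resum' : ∀ K t, |t| ≤ l₀ → K₀ ≤ K → ∀ c ∈ Bad' K t, ∑ τ ∈ fibre π T K c, dead' K t τ ≤ Rf' K c)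
    (F'_nonneg : ∀ K t, |t| ≤ l₀ → K₀ ≤ K → ∀ c ∈ Bad' K t, 0 ≤ Fc' K c)
    -- the (2.5) side condition on the size function the (ID) data are built over
    (R : ℕ → ℕ → ℕ) (hR : ∀ K s, s ≤ K → B14.IsRj F.L rr ((D.C ⟨K, F.m, g₀ K⟩).flow.g s) (R K s))
    -- the four TREE-SLOT (ID) binders over the canonical cells and the canonical run family, LE form
    (y : ℕ → ℕ → (Fin d → ℕ) → Gen PEv → ℝ)
    (hy0 : ∀ K, ∀ j ≤ K, ∀ z ∈ cellN d n F.L K (K - j), ∀ Gs ∈ canonFam Dcap Ncap K j, 0 ≤ y K j z Gs)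
    (hlabTLE : ∀ K, K₀ ≤ K → ∀ j ≤ K, ∀ z ∈ cellN d n F.L K (K - j), ∀ Gs ∈ canonFam Dcap Ncap K j,
      y K j z Gs ≤ 0 ∨ ∃ G' : Gen ε, ConsistentTLE sh C K (R K) G' ∧ G'.WF (dictWT sh (R K) C.n₁) ∧
        K < G'.reach (dictWT sh (R K) C.n₁) ∧ relabel (shape ∘ sh) G' = Gs ∧
        y K j z Gs ≤ ((F.L : ℝ) ^ d) ^ partnerAges (PEv.step ∘ sh) G' *
          (Real.exp (-credits (credit C (D.C ⟨K, F.m, g₀ K⟩).flow.g ∘ sh) G') *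
            Real.exp (lifeCost (dictWT sh (R K) C.n₁) (costT sh C K (R K)) G')))
    (str : ℕ → κc → Finset (BSlot (Fin d → ℕ) PEv))
    (hinj : ∀ K t, |t| ≤ l₀ → K₀ ≤ K → Set.InjOn (str K) (Bad' K t))
    (hstr : ∀ K t, |t| ≤ l₀ → K₀ ≤ K → ∀ cl ∈ Bad' K t,
      str K cl ⊆ bliveSlots (cellN d n F.L) (canonFam Dcap Ncap) K ∧
        ∃ o ∈ boldSlots (cellN d n F.L) (canonFam Dcap Ncap) jhalf K, o ∈ str K cl)
    (hF : ∀ K t, |t| ≤ l₀ → K₀ ≤ K → ∀ cl ∈ Bad' K t, Fc K cl * Rf K cl ≤ famWeight (bslotPrice (y K)) (str K cl))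
    (hF' : ∀ K t, |t| ≤ l₀ → K₀ ≤ K → ∀ cl ∈ Bad' K t,
      Fc' K cl * Rf' K cl ≤ famWeight (bslotPrice (y K)) (str K cl))
    -- the seam's other inputs (NE7c socket, NE7 core budget, four summable rates)
    (hSh : ShellWeightBound l₀ T A A' shA shB Wsh)
    (hTB : ReindexedBudget l₀ vol T (fun K t τ => A K t τ - shA K t τ) (fun K t τ => A' K t τ - shB K t τ)
      (badOfClass π T Bad') Cc Rr CcRec RrRec ν u s₂ q₀ r s)
    (hr : Summable r) (hu : Summable u) (hs : Summable s) (hs₂ : Summable s₂) :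
    ∃ K₁ K₂, K₀ ≤ K₁ ∧ HybridNE7 l₀ vol (fun K => T (K₁ + (K₂ + K))) (fun K => A (K₁ + (K₂ + K)))
      (fun K => A' (K₁ + (K₂ + K))) (fun K => badOfClass π T Bad' (K₁ + (K₂ + K)))
      (fun K => constOf l₀ B (max (em g) 0) n₁ c₀ Nup *
        recordsBudget (birthMass C) C.κ₁ ((n : ℝ) ^ d) ((F.L : ℝ) ^ d) (Real.log 2) jhalf (K₁ + (K₂ + K)))
      (fun K => shA (K₁ + (K₂ + K))) (fun K => shB (K₁ + (K₂ + K))) (fun K => Wsh (K₁ + (K₂ + K)))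
      (fun K => (r (K₁ + (K₂ + K)) + u (K₁ + (K₂ + K))) + (s (K₁ + (K₂ + K)) + s₂ (K₁ + (K₂ + K)))) := by
  -- (i) the typed flow along the tuned runs (S8), clamped at the cutoff
  obtain ⟨h27, h29, hx1, -⟩ := flowBinders_of_tuned D hb hlo hhi hγ hγβ S hp₀ hrr ht R hR
  set gr : ℕ → ℕ → ℝ := fun K s => (D.C ⟨K, F.m, g₀ K⟩).flow.g (min s K) with hgr
  have h27' : ∀ K, K₀ ≤ K → B14.FlowIneq27 (gr K) β' β₀ C.p₀ K := fun K _ => flowIneq27_clamp (h27 K)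
  have h29' : ∀ K, K₀ ≤ K → B14FlowStep.FlowIneq29 (R K) (gr K) F.L β' β₀ K := fun K _ => flowIneq29_clamp (h29 K)
  have hR' : ∀ K, K₀ ≤ K → ∀ s, s ≤ K → B14.IsRj F.L rr (gr K s) (R K s) := by
    intro K _ s hs
    show B14.IsRj F.L rr ((D.C ⟨K, F.m, g₀ K⟩).flow.g (min s K)) (R K s)
    rw [min_eq_left hs]; exact hR K s hs
  have hx1' : ∀ K, K₀ ≤ K → ∀ s, s ≤ K → 1 ≤ Real.log ((gr K s) ^ 2)⁻¹ := by
    intro K _ s hs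
    show 1 ≤ Real.log (((D.C ⟨K, F.m, g₀ K⟩).flow.g (min s K)) ^ 2)⁻¹
    rw [min_eq_left hs]; exact hx1 K s hs
  have hir' : ∀ K, K₀ ≤ K → payThresholdRoot C F.L rr β₀ ≤ Real.log ((gr K K) ^ 2)⁻¹ := by
    intro K _
    show _ ≤ Real.log (((D.C ⟨K, F.m, g₀ K⟩).flow.g (min K K)) ^ 2)⁻¹
    rw [min_self, (ht K).2]; exact hir
  have hP : ∀ K s, 0 ≤ p0Profile C.A₀ C.p₀ (gr K s) := fun K s =>
    p0Profile_nonneg_of_one_le_log C.p₀ h.A₀_pos.le (hx1 K (min s K) (min_le_right s K))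
  -- (iii) the two `Regeneration` runs with ONE constant (S11)
  obtain ⟨hA, hA'⟩ := regeneration_pair_of_cor3With D hsign hcor hγB ht hobs hbd hα hα' hc₀ hfloor hfloor' hsites
    hsites' hnup hmup bad_subset up dead_nonneg resum F_nonneg up' dead'_nonneg resum' F'_nonneg
  have hCn : 0 ≤ constOf l₀ B (max (em g) 0) n₁ c₀ Nup := constOf_nonneg hNup hc₀.le
  -- (ii) cells, matching scale, rates (S12 §1 + §2)
  have hL1 : 1 ≤ F.L := le_trans (by norm_num) (two_le_L F)
  have hLpos : (0 : ℝ) < F.L := by exact_mod_cast (lt_of_lt_of_le (by norm_num) hL1)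
  obtain ⟨hrate, h1, hx⟩ := treeRates_of_large hL1 d (birthMass_nonneg hμ) hκ₁ hE₀
  -- the labelled-price binder in the LE exit's `Δ = 1` form, over the clamped run
  have hlab' : ∀ K, K₀ ≤ K → ∀ j ≤ K, ∀ z ∈ cellN d n F.L K (K - j), ∀ Gs ∈ canonFam Dcap Ncap K j,
      y K j z Gs ≤ 0 ∨ ∃ G' : Gen ε, ConsistentTLE sh C K (R K) G' ∧ G'.WF (dictWT sh (R K) C.n₁) ∧
        K < G'.reach (dictWT sh (R K) C.n₁) ∧ relabel (shape ∘ sh) G' = Gs ∧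
        y K j z Gs ≤ 1 * (((F.L : ℝ) ^ d) ^ partnerAges (PEv.step ∘ sh) G' *
          (Real.exp (-credits (credit C (gr K) ∘ sh) G') *
            Real.exp (lifeCost (dictWT sh (R K) C.n₁) (costT sh C K (R K)) G'))) := by
    intro K hK j hj z hz Gs hGs
    rcases hlabTLE K hK j hj z hz Gs hGs with h0 | ⟨G', hc, hw, hreach, hrel, hy⟩
    · exact Or.inl h0
    · refine Or.inr ⟨G', hc, hw, hreach, hrel, ?_⟩
      rw [one_mul, credits_clampLE sh C _ hc]
      exact hy
  have hmain := relWeightBound_canon_of_payThresholdRootLE sh h hμ (cellN d n F.L) (V := (n : ℝ) ^ d)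
    (Λ := (F.L : ℝ) ^ d) (by positivity) (pow_pos hLpos d) (card_cellN_le d n hL1) Dcap Ncap jhalf jhalf_le
    (c := 1 / 2) (by norm_num) half_le_sub_jhalf (Δ := 1) le_rfl hA hA' hCn R gr (fun _ => β') h27' h29' hR' hx1'
    hir' hP (Real.log_nonneg one_le_two) hrate (pow_nonneg hLpos.le d) h1 hx y hy0 hlab' str hinj hstr hF hF'
  have e0 : (1 : ℝ) * birthMass C = birthMass C := one_mul _
  rw [e0] at hmain
  exact hybridNE7_of_eventually hmain hSh hTB hr hu hs hs₂

end ExitLevel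

/-! ## §2 The term-level END with the fine families and the per-occupant multiplicity binder, explicit threshold -/

section Terms

variable {F : T4Family} {G : Type*} [GaugeGroup G] [MeasurableSpace G] [HaarData G] [RegularGaugeGroup G]
variable {ε : Type*} [DecidableEq ε] {ω : Type*} [DecidableEq ω]
variable {ι : Type*} [DecidableEq ι] {l₀ vol : ℝ} {K₀ : ℕ} {T : ℕ → Finset ι} {A A' shA shB : ℕ → ℝ → ι → ℝ}
  {dead dead' : ℕ → ℝ → ι → ℝ} {nup mup : ℕ → ℝ → ℝ} {Nup : ℝ}
  {Cc Rr CcRec RrRec : ℕ → ℝ → ι → ℝ} {ν u s₂ q₀ r s Wsh : ℕ → ℝ}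

/-- **NE7b's COUNT EXIT WITH THE LIVE STRUCTURES READ PER TERM (LE), THE NUMERATOR OVER FINE MEMBER FAMILIES, AT
THE EXPLICIT (ROOT) PAY THRESHOLD.**  `HistoryAssemblyRealiseMult.hybridNE7_of_termReadingLE_mult` (p219242) VERBATIM with
the single binder `hir` re-lettered `irThresholdTLE ↦ HistoryPayThresholdRoot.payThresholdRoot`; proof = the same
composition over §1's `hybridNE7_of_treeBinders_canonPayRoot`.  Conclusion and every other binder byte-identical.
NE7b NOT proved. [folklore] -/
theorem hybridNE7_of_termReadingLE_multPayRoot (D : FiniteEpsData F G) (sh : ε → PEv) {C : T4PrintedShapeBanking.Consts}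
    {rr : ℕ} {β₀ : ℝ} (h : ThresholdOK C F.L rr β₀) (hμ : 0 < C.μ) (d n : ℕ) (Dcap Ncap : ℕ → ℕ)
    (hκ₁ : (d : ℝ) * Real.log F.L + 2 * Real.log 2 ≤ C.κ₁) (hE₀ : Real.log (2 + birthMass C) ≤ C.E₀)
    -- the flow side (⇐ BetaPertH, displayed) and tuning
    {γ₀ γb b β' : ℝ} {pe : ℕ} (hb : 0 ≤ b) (hlo : FlowStep.BetaLowerH b γ₀ D.βfun)
    (hhi : FlowStep.BetaUpperH β' γ₀ D.βfun) (hγ : γb ≤ γ₀) (hγβ : γb ^ 2 * β' < 1)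
    (S : B14FlowStep.SmallnessFor γb β' β₀ F.L pe) (hp₀ : C.p₀ ≤ pe) (hrr : rr ≤ pe)
    {g : ℝ} {g₀ : ℕ → ℝ} (ht : D.Tuned γb g g₀)
    (hir : payThresholdRoot C F.L rr β₀ ≤ Real.log (g ^ 2)⁻¹)
    -- the (B) side
    (hsign : B16.SignConventions D.C) {γB : ℝ} {em ep : ℝ → ℝ} (hcor : B16.Cor3With D.C γB em ep) (hγB : γb ≤ γB)
    {obs : (K : ℕ) → GaugeField (F.P K) 0 G → ℝ} {B : ℝ}
    (hobs : ∀ K, Measurable (obs K)) (hbd : ∀ K U, |obs K U| ≤ B)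
    (hα : ∀ K t, |t| ≤ l₀ → K₀ ≤ K →
      ∫ U, Real.exp (t * obs K U) * D.dens K (g₀ K) 0 U ∂fieldMeasure (F.P K) 0 G ≤ ∑ τ ∈ T K, A K t τ)
    (hα' : ∀ K t, |t| ≤ l₀ → K₀ ≤ K →
      ∫ U, Real.exp (t * obs (K + 1) U) * D.dens (K + 1) (g₀ (K + 1)) 0 U ∂fieldMeasure (F.P (K + 1)) 0 G ≤
        ∑ τ ∈ T K, A' K t τ)
    {c₀ n₁ : ℝ} (hc₀ : 0 < c₀) (hfloor : ∀ K, K₀ ≤ K → c₀ ≤ smallFieldMass D K (g₀ K))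
    (hfloor' : ∀ K, K₀ ≤ K → c₀ ≤ smallFieldMass D (K + 1) (g₀ (K + 1)))
    (hsites : ∀ K, K₀ ≤ K → ((D.C ⟨K, F.m, g₀ K⟩).numSites K : ℝ) ≤ n₁)
    (hsites' : ∀ K, K₀ ≤ K → ((D.C ⟨K + 1, F.m, g₀ (K + 1)⟩).numSites (K + 1) : ℝ) ≤ n₁)
    (hNup : 0 ≤ Nup) (hnup : ∀ K t, |t| ≤ l₀ → K₀ ≤ K → 0 ≤ nup K t ∧ nup K t ≤ Nup)
    (hmup : ∀ K t, |t| ≤ l₀ → K₀ ≤ K → 0 ≤ mup K t ∧ mup K t ≤ Nup)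
    -- the (2.5) side condition on the size function
    (R : ℕ → ℕ → ℕ) (hR : ∀ K s, s ≤ K → B14.IsRj F.L rr ((D.C ⟨K, F.m, g₀ K⟩).flow.g s) (R K s))
    -- H3, PER TERM: the live members of the terms and their reading
    (mem : ℕ → ι → Finset ((Fin d → ℕ) × Gen ε))
    (H : TermReadingLE sh C (cellN d n F.L) Dcap Ncap jhalf K₀ R T mem)
    -- the FINE member families and their slots (displayed compatibilities with the live classes)
    (gmem : ℕ → ι → Finset ω) (gslot : ω → BSlot (Fin d → ℕ) PEv)
    (hslots : ∀ K, K₀ ≤ K → ∀ τ ∈ T K, (gmem K τ).image gslot = bstrOf sh mem K τ)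
    (hginj : ∀ K, K₀ ≤ K → ∀ τ ∈ badTerms mem jhalf T K, Set.InjOn gslot (gmem K τ : Set ω))
    -- a nonnegative per-member price for each run, and THE PER-OCCUPANT MULTIPLICITY BOUND at every tree slot
    (p p' : ℕ → ω → ℝ) (hp : ∀ K w, 0 ≤ p K w) (hp' : ∀ K w, 0 ≤ p' K w)
    (hocc : ∀ K, K₀ ≤ K → ∀ s, ∀ w ∈ gocc mem jhalf T gmem gslot K s,
      ((gocc mem jhalf T gmem gslot K s).card : ℝ) * p K w ≤
        bslotPrice (yT sh C ((F.L : ℝ) ^ d) R (fun K => (D.C ⟨K, F.m, g₀ K⟩).flow.g) mem jhalf T K) s)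
    (hocc' : ∀ K, K₀ ≤ K → ∀ s, ∀ w ∈ gocc mem jhalf T gmem gslot K s,
      ((gocc mem jhalf T gmem gslot K s).card : ℝ) * p' K w ≤
        bslotPrice (yT sh C ((F.L : ℝ) ^ d) R (fun K => (D.C ⟨K, F.m, g₀ K⟩).flow.g) mem jhalf T K) s)
    -- H3, PER FINE MEMBER FAMILY: the live price of the family of every bad term, both runs
    {FcM RfM FcM' RfM' : ℕ → Finset ω → ℝ}
    (hPM : ∀ K t, |t| ≤ l₀ → K₀ ≤ K → ∀ τ ∈ badTerms mem jhalf T K,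
      FcM K (gmem K τ) * RfM K (gmem K τ) ≤ ∏ w ∈ gmem K τ, p K w)
    (hPM' : ∀ K t, |t| ≤ l₀ → K₀ ≤ K → ∀ τ ∈ badTerms mem jhalf T K,
      FcM' K (gmem K τ) * RfM' K (gmem K τ) ≤ ∏ w ∈ gmem K τ, p' K w)
    -- H3: the remaining `Regeneration` numerator readings, over the FINE families of the bad terms (the dead parts of
    -- the histories with the same fine family resummed; no placement sum inside)
    (upM : ∀ K t, |t| ≤ l₀ → K₀ ≤ K → ∀ k ∈ badGMems mem jhalf T gmem K, ∀ τ ∈ fibre gmem T K k,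
      A K t τ ≤ dead K t τ * FcM K k * nup K t)
    (deadM_nonneg : ∀ K t, |t| ≤ l₀ → K₀ ≤ K → ∀ k ∈ badGMems mem jhalf T gmem K, ∀ τ ∈ fibre gmem T K k,
      0 ≤ dead K t τ)
    (resumM : ∀ K t, |t| ≤ l₀ → K₀ ≤ K → ∀ k ∈ badGMems mem jhalf T gmem K,
      ∑ τ ∈ fibre gmem T K k, dead K t τ ≤ RfM K k)
    (FM_nonneg : ∀ K t, |t| ≤ l₀ → K₀ ≤ K → ∀ k ∈ badGMems mem jhalf T gmem K, 0 ≤ FcM K k)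
    (upM' : ∀ K t, |t| ≤ l₀ → K₀ ≤ K → ∀ k ∈ badGMems mem jhalf T gmem K, ∀ τ ∈ fibre gmem T K k,
      A' K t τ ≤ dead' K t τ * FcM' K k * mup K t)
    (deadM'_nonneg : ∀ K t, |t| ≤ l₀ → K₀ ≤ K → ∀ k ∈ badGMems mem jhalf T gmem K, ∀ τ ∈ fibre gmem T K k,
      0 ≤ dead' K t τ)
    (resumM' : ∀ K t, |t| ≤ l₀ → K₀ ≤ K → ∀ k ∈ badGMems mem jhalf T gmem K,
      ∑ τ ∈ fibre gmem T K k, dead' K t τ ≤ RfM' K k)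
    (FM'_nonneg : ∀ K t, |t| ≤ l₀ → K₀ ≤ K → ∀ k ∈ badGMems mem jhalf T gmem K, 0 ≤ FcM' K k)
    -- the seam's other inputs
    (hSh : ShellWeightBound l₀ T A A' shA shB Wsh)
    (hTB : ReindexedBudget l₀ vol T (fun K t τ => A K t τ - shA K t τ) (fun K t τ => A' K t τ - shB K t τ)
      (badOfClass (bstrOf sh mem) T (fun K _ => badClasses sh mem jhalf T K)) Cc Rr CcRec RrRec ν u s₂ q₀ r s)
    (hr : Summable r) (hu : Summable u) (hs : Summable s) (hs₂ : Summable s₂) :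
    ∃ K₁ K₂, K₀ ≤ K₁ ∧ HybridNE7 l₀ vol (fun K => T (K₁ + (K₂ + K))) (fun K => A (K₁ + (K₂ + K)))
      (fun K => A' (K₁ + (K₂ + K)))
      (fun K => badOfClass (bstrOf sh mem) T (fun K _ => badClasses sh mem jhalf T K) (K₁ + (K₂ + K)))
      (fun K => constOf l₀ B (max (em g) 0) n₁ c₀ Nup *
        recordsBudget (birthMass C) C.κ₁ ((n : ℝ) ^ d) ((F.L : ℝ) ^ d) (Real.log 2) jhalf (K₁ + (K₂ + K)))
      (fun K => shA (K₁ + (K₂ + K))) (fun K => shB (K₁ + (K₂ + K))) (fun K => Wsh (K₁ + (K₂ + K)))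
      (fun K => (r (K₁ + (K₂ + K)) + u (K₁ + (K₂ + K))) + (s (K₁ + (K₂ + K)) + s₂ (K₁ + (K₂ + K)))) := by
  have hLpos : (0 : ℝ) < F.L := by exact_mod_cast (lt_of_lt_of_le (by norm_num) (two_le_L F))
  have hΛ : (0 : ℝ) ≤ (F.L : ℝ) ^ d := pow_nonneg hLpos.le d
  exact hybridNE7_of_treeBinders_canonPayRoot D sh h hμ d n Dcap Ncap hκ₁ hE₀ hb hlo hhi hγ hγβ S hp₀ hrr ht hir hsign hcor
    hγB hobs hbd hα hα' hc₀ hfloor hfloor' hsites hsites' hNup hnup hmup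
    (π := bstrOf sh mem) (Bad' := fun K _ => badClasses sh mem jhalf T K)
    (Fc := fun _ _ => (1 : ℝ)) (Rf := RfC mem jhalf T gmem gslot FcM RfM) (Fc' := fun _ _ => (1 : ℝ))
    (Rf' := RfC mem jhalf T gmem gslot FcM' RfM') (dead := deadC gmem FcM dead) (dead' := deadC gmem FcM' dead')
    (fun K _ _ _ => badClasses_subset_classIndex sh mem jhalf T K)
    (up_coarse upM) (deadC_nonneg deadM_nonneg FM_nonneg) (resum_coarse hslots resumM FM_nonneg)
    (fun _ _ _ _ _ _ => zero_le_one)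
    (up_coarse upM') (deadC_nonneg deadM'_nonneg FM'_nonneg) (resum_coarse hslots resumM' FM'_nonneg)
    (fun _ _ _ _ _ _ => zero_le_one) R hR
    (yT sh C ((F.L : ℝ) ^ d) R (fun K => (D.C ⟨K, F.m, g₀ K⟩).flow.g) mem jhalf T)
    (fun K j _ z _ Gs _ => yT_nonneg hΛ K j z Gs)
    (fun K hK j hj z hz Gs hGs => hlabTLE_of_termReadingLE H (canonFam Dcap Ncap) K hK j hj z hz Gs hGs)
    (fun _ c => c) (fun K t _ _ => Set.injOn_id _)
    (fun K t _ hK c hc => hstr_of_termReadingLE H K hK hc)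
    (hF_of_multReading hΛ hginj hp hocc hPM) (hF_of_multReading hΛ hginj hp' hocc' hPM') hSh hTB hr hu hs hs₂

end Terms

end

end Summit.QuantumFields.BalabanUV.T4Continuum.HistoryAssemblyTreesPayRoot
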